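import Literature.Geometry.Kaehler.SiegelTorusThetaNullModular
import HarnessLib

/-!
# `Γ_g` acts on the `2^{2g}` theta characteristics by permutations preserving parity; the set and the
# number of vanishing theta constants are modular invariants

Layer `Literature/Geometry/Kaehler`, namespace `Literature.Geometry.Kaehler.ComplexTorus` (lane
`lit-hodgefound`, Layer A4, theta-divisor row A4-17; prover seat `lit-hodgefound-p23`, row «A4-17(t)»).
Sequel of `SiegelTorusThetaNullModular.lean` (the action `M[·]` of `Sp_{2g}(ℤ)` on half-integer
characteristics in Lange's integral form `k' = δk − γl + (γᵗδ)₀`, `l' = αl − βk + (αᵗβ)₀`, its parity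
invariance `even_dotProduct_symplecticChar_iff`, and `ϑ[k'/2; l'/2](0, M(Z)) = 0 ↔ ϑ[k/2; l/2](0, Z) = 0`)
and of `SiegelTorusThetaNullCount.lean` (`vanishingThetaNulls Ω ⊂ (ℤ/2)^{2g}`: the even characteristics
modulo `2` whose theta constant vanishes at `Ω`; `sumElim_intCast_mem_vanishingThetaNulls_iff`).

Source followed (held text, read at the quoted chunk): S. Grushevsky, R. Salvati Manni, *Gradients of odd
theta functions*, J. reine angew. Math. 573 (2004) [held `paper:arxiv-math_0310085` p0003 L77–L87]:
"The group `Γ_g` acts on the set of characteristics as follows: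
`γ(ε;δ) := (d −c; −b a)(ε;δ) + (diag(cdᵗ); diag(abᵗ))`, where the resulting characteristics is taken
modulo 2. This action is not transitive, in fact the parity of the characteristics is an invariant."
and L107–L108 "The action of `Γ_g/Γ_g(2)` on the set of characteristics is by permutations."; with
S. Grushevsky, R. Salvati Manni, *Jacobians with a vanishing theta-null in genus 4* (2008), Definitions 5–6
[held `paper:arxiv-math_0605160` p0004] for the same formula `M(ε;δ)` and the transformation of theta
constants.

What is here. Two plumbing definitions with bodies over `ℤ` (GSM's matrix `(d −c; −b a) = ᵗM⁻¹` and shift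
`(diag(cdᵗ); diag(abᵗ))`, for `M = (a b; c d) ∈ Sp_{2g}(ℤ)` — the tree's `(α β; γ δ)`), ONE definition with
body `symplecticCharPerm hM : (ℤ/2)^{2g} ≃ (ℤ/2)^{2g}` (the printed action AS A PERMUTATION of the finite set
of characteristics, inverse `q ↦ ᵗM(q − shift)`), and theorems; no named fact, net debt `0`.

* `charActionMatrix_mul_transpose` (`(d −c; −b a) · ᵗM = 1`: the symplectic relations),
  `transpose_mul_charActionMatrix`; `charActionMatrix_mulVec_add_shift` (on integral lifts `(k, l)` the
  action is Lange's `(k', l')`).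
* **`symplecticCharPerm`** ("the action … on the set of characteristics is by permutations"),
  `symplecticCharPerm_apply`, **`symplecticCharPerm_sumElim_intCast`** (`= (k̄', l̄')` on the class of
  `(k, l)`), **`sum_mul_symplecticCharPerm_eq_zero_iff`** / `sum_mul_symplecticCharPerm_eq` ("the parity of
  the characteristics is an invariant"), `symplecticCharPerm_J` (validation: for `J = (0 −1; 1 0)` the
  permutation swaps `ε` and `δ`).
* **`symplecticCharPerm_mem_vanishingThetaNulls_iff`** — `γ·p ∈ vanishingThetaNulls (M(Z)) ↔
  p ∈ vanishingThetaNulls Z`; **`image_symplecticCharPerm_vanishingThetaNulls`** (the set of vanishing even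
  theta constants of `M(Z)` is the image of that of `Z`); **`natCard_vanishingThetaNulls_moeb_eq`** (THE
  NUMBER OF VANISHING EVEN THETA CONSTANTS IS A MODULAR INVARIANT of the ppav), the translation case
  `natCard_vanishingThetaNulls_add_intCast_eq`, and on the torus
  **`natCard_twoTorsion_inter_thetaDivisor_moeb_eq`** (`#(X_{M(Z)}[2] ∩ Θ) = #(X_Z[2] ∩ Θ)`, via the tree's
  `natCard_twoTorsion_inter_thetaDivisor_eq_add`).

Not here: transitivity of the action on even / odd characteristics, the level groups `Γ_g(2) ⊂ Γ_g(4,8)`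
(the kernel of the action), theta constants as modular forms.

## References

* [GrushevskySalvatiManni2004Gradients] S. Grushevsky, R. Salvati Manni, *Gradients of odd theta
  functions*, J. reine angew. Math. 573 (2004), 45–59 (arXiv:math/0310085), p. 3 of the held text
  (L77–L87, L107–L108).
* [GrushevskySalvatiManni2008] S. Grushevsky, R. Salvati Manni, *Jacobians with a vanishing theta-null in
  genus 4*, Israel J. Math. 164 (2008), Definitions 5–6 (p0004 of the held text).
* [Lange2023AbelianVarietiesComplex] H. Lange, *Abelian Varieties over the Complex Numbers* (2023),
  §3.1.2 Lemma 3.1.3, §3.1.3 Prop. 3.1.7 (`ᵗM⁻¹ = (δ −γ; −β α)`), §3.3.1 Lemma 3.3.1.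
* [vanGeemen1992PicardModular] B. van Geemen, *Projective models of Picard modular varieties*, LNM 1515
  (1992), §3.5–§3.6 (the vanishing theta nulls of a ppav).
* [MumfordTata1] D. Mumford, *Tata Lectures on Theta I*, Ch. II §5.
-/

noncomputable section

open scoped Manifold Topology
open scoped Real
open Set Function Complex Matrix Filter
open Literature.Analysis.SpecialFunctions Literature.Analysis.Complex

namespace Literature.Geometry.Kaehler

namespace ComplexTorus

open Literature.NumberTheory.Automorphic (siegelUpperHalfSpace)
open Literature.NumberTheory.ModularForms.SiegelUpperHalfSpace (moeb denom)

variable {n : ℕ}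

/-! ### §1 GSM's matrix `(d −c; −b a) = ᵗM⁻¹` and the shift `(diag(cdᵗ); diag(abᵗ))` over `ℤ` -/

section IntegerAction

variable {M : Matrix (Fin n ⊕ Fin n) (Fin n ⊕ Fin n) ℤ}

/-- **GSM's matrix `(d −c; −b a)`** acting on characteristics, for `M = (a b; c d)` (the tree's
`(α β; γ δ)`): the matrix `(δ −γ; −β α) = ᵗM⁻¹` of Lange's Prop. 3.1.7.
[cite: GrushevskySalvatiManni2004Gradients, p0003 L77–L84 of the held text]
[cite: Lange2023AbelianVarietiesComplex, §3.1.3 proof of Prop. 3.1.7 (p0161)] -/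
def charActionMatrix (M : Matrix (Fin n ⊕ Fin n) (Fin n ⊕ Fin n) ℤ) :
    Matrix (Fin n ⊕ Fin n) (Fin n ⊕ Fin n) ℤ :=
  Matrix.fromBlocks M.toBlocks₂₂ (-M.toBlocks₂₁) (-M.toBlocks₁₂) M.toBlocks₁₁

/-- **GSM's shift `(diag(cdᵗ); diag(abᵗ))`** of the action on characteristics (the tree's
`((γᵗδ)₀; (αᵗβ)₀)`). [cite: GrushevskySalvatiManni2004Gradients, p0003 L77–L84 of the held text]
[cite: Lange2023AbelianVarietiesComplex, §3.3.1 Lemma 3.3.1 (b) (p0170)] -/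
def charActionShift (M : Matrix (Fin n ⊕ Fin n) (Fin n ⊕ Fin n) ℤ) : Fin n ⊕ Fin n → ℤ :=
  Sum.elim (Matrix.diag (M.toBlocks₂₁ * M.toBlocks₂₂ᵀ)) (Matrix.diag (M.toBlocks₁₁ * M.toBlocks₁₂ᵀ))

/-- Unfolding of `charActionMatrix`. [cite: GrushevskySalvatiManni2004Gradients, p0003 L77–L84 of the held text] -/
theorem charActionMatrix_def (M : Matrix (Fin n ⊕ Fin n) (Fin n ⊕ Fin n) ℤ) :
    charActionMatrix M = Matrix.fromBlocks M.toBlocks₂₂ (-M.toBlocks₂₁) (-M.toBlocks₁₂) M.toBlocks₁₁ :=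
  rfl

/-- Unfolding of `charActionShift`. [cite: GrushevskySalvatiManni2004Gradients, p0003 L77–L84 of the held text] -/
theorem charActionShift_def (M : Matrix (Fin n ⊕ Fin n) (Fin n ⊕ Fin n) ℤ) :
    charActionShift M =
      Sum.elim (Matrix.diag (M.toBlocks₂₁ * M.toBlocks₂₂ᵀ)) (Matrix.diag (M.toBlocks₁₁ * M.toBlocks₁₂ᵀ)) :=
  rfl

/-- **`(δ −γ; −β α) · ᵗM = 1` for `M ∈ Sp_{2g}(ℤ)`** (the symplectic relations `αᵗβ = βᵗα`,
`γᵗδ = δᵗγ`, `αᵗδ − βᵗγ = 1` of Lemma 3.1.3 for `ᵗM`), i.e. `(δ −γ; −β α) = ᵗM⁻¹`.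
[cite: Lange2023AbelianVarietiesComplex, §3.1.2 Lemma 3.1.3 (p0159); §3.1.3 proof of Prop. 3.1.7 (p0161)] -/
theorem charActionMatrix_mul_transpose (hM : M ∈ Matrix.symplecticGroup (Fin n) ℤ) :
    charActionMatrix M * Mᵀ = 1 := by
  obtain ⟨h1, h2, h3⟩ := blocks_rel_transpose hM
  have h3' : M.toBlocks₂₂ * M.toBlocks₁₁ᵀ - M.toBlocks₂₁ * M.toBlocks₁₂ᵀ = 1 := by
    have := congrArg Matrix.transpose h3
    simpa [Matrix.transpose_sub, Matrix.transpose_mul, Matrix.transpose_transpose] using this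
  have hT : Mᵀ = Matrix.fromBlocks M.toBlocks₁₁ᵀ M.toBlocks₂₁ᵀ M.toBlocks₁₂ᵀ M.toBlocks₂₂ᵀ := by
    conv_lhs => rw [← Matrix.fromBlocks_toBlocks M]
    rw [Matrix.fromBlocks_transpose]
  rw [charActionMatrix, hT, Matrix.fromBlocks_multiply, ← Matrix.fromBlocks_one]
  congr 1
  · rw [Matrix.neg_mul, ← sub_eq_add_neg, h3']
  · rw [Matrix.neg_mul, ← sub_eq_add_neg, sub_eq_zero, h2]
  · rw [Matrix.neg_mul, neg_add_eq_sub, sub_eq_zero, h1]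
  · rw [Matrix.neg_mul, neg_add_eq_sub, h3]

/-- **`ᵗM · (δ −γ; −β α) = 1`** (a one-sided inverse of a square integral matrix is two-sided).
[cite: Lange2023AbelianVarietiesComplex, §3.1.3 proof of Prop. 3.1.7 (p0161)] -/
theorem transpose_mul_charActionMatrix (hM : M ∈ Matrix.symplecticGroup (Fin n) ℤ) :
    Mᵀ * charActionMatrix M = 1 :=
  mul_eq_one_comm.1 (charActionMatrix_mul_transpose hM)

/-- **On integral lifts the action is Lange's `M[·]`**: for `k, l ∈ ℤ^g`,
`(δ −γ; −β α)(k; l) + ((γᵗδ)₀; (αᵗβ)₀) = (δk − γl + (γᵗδ)₀; αl − βk + (αᵗβ)₀) = (k'; l')`.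
[cite: GrushevskySalvatiManni2008, Definition 5 (p0004 of the held text)]
[cite: Lange2023AbelianVarietiesComplex, §3.3.1 Lemma 3.3.1 (b) (p0170)] -/
theorem charActionMatrix_mulVec_add_shift (M : Matrix (Fin n ⊕ Fin n) (Fin n ⊕ Fin n) ℤ)
    (k l : Fin n → ℤ) :
    charActionMatrix M *ᵥ Sum.elim k l + charActionShift M =
      Sum.elim (M.toBlocks₂₂ *ᵥ k - M.toBlocks₂₁ *ᵥ l + Matrix.diag (M.toBlocks₂₁ * M.toBlocks₂₂ᵀ))
        (M.toBlocks₁₁ *ᵥ l - M.toBlocks₁₂ *ᵥ k + Matrix.diag (M.toBlocks₁₁ * M.toBlocks₁₂ᵀ)) := by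
  rw [charActionMatrix, Matrix.fromBlocks_mulVec, Sum.elim_comp_inl, Sum.elim_comp_inr, charActionShift]
  funext s
  rcases s with i | i
  · simp only [Pi.add_apply, Sum.elim_inl, Matrix.neg_mulVec, Pi.neg_apply, Pi.sub_apply]
    ring
  · simp only [Pi.add_apply, Sum.elim_inr, Matrix.neg_mulVec, Pi.neg_apply, Pi.sub_apply]
    ring

end IntegerAction

/-! ### §2 The action on the `2^{2g}` characteristics modulo `2` is by permutations -/

section Perm

variable {M : Matrix (Fin n ⊕ Fin n) (Fin n ⊕ Fin n) ℤ}

/-- **"The group `Γ_g` acts on the set of characteristics … taken modulo 2 … by permutations"**: for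
`M ∈ Sp_{2g}(ℤ)`, GSM's `γ(ε;δ) := (d −c; −b a)(ε;δ) + (diag(cdᵗ); diag(abᵗ)) mod 2` AS A PERMUTATION of
`(ℤ/2)^{2g}` (characteristics `p = (ε, δ)`, `ε = p ∘ inl`, `δ = p ∘ inr`), with inverse
`q ↦ ᵗM(q − (diag(cdᵗ); diag(abᵗ)))` (`(d −c; −b a) = ᵗM⁻¹`).
[cite: GrushevskySalvatiManni2004Gradients, p0003 L77–L87 and L107–L108 of the held text]
[cite: GrushevskySalvatiManni2008, Definition 5 (p0004 of the held text)] -/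
def symplecticCharPerm (hM : M ∈ Matrix.symplecticGroup (Fin n) ℤ) :
    (Fin n ⊕ Fin n → ZMod 2) ≃ (Fin n ⊕ Fin n → ZMod 2) where
  toFun p := (charActionMatrix M).map (Int.castRingHom (ZMod 2)) *ᵥ p +
    fun s ↦ ((charActionShift M s : ℤ) : ZMod 2)
  invFun q := Mᵀ.map (Int.castRingHom (ZMod 2)) *ᵥ (q - fun s ↦ ((charActionShift M s : ℤ) : ZMod 2))
  left_inv p := by
    simp only [add_sub_cancel_right, Matrix.mulVec_mulVec]
    rw [← Matrix.map_mul, transpose_mul_charActionMatrix hM,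
      Matrix.map_one _ (map_zero _) (map_one _), Matrix.one_mulVec]
  right_inv q := by
    simp only [Matrix.mulVec_mulVec]
    rw [← Matrix.map_mul, charActionMatrix_mul_transpose hM,
      Matrix.map_one _ (map_zero _) (map_one _), Matrix.one_mulVec, sub_add_cancel]

/-- Unfolding of `symplecticCharPerm`. [cite: GrushevskySalvatiManni2004Gradients, p0003 L77–L84 of the held text] -/
theorem symplecticCharPerm_apply (hM : M ∈ Matrix.symplecticGroup (Fin n) ℤ)
    (p : Fin n ⊕ Fin n → ZMod 2) :
    symplecticCharPerm hM p = (charActionMatrix M).map (Int.castRingHom (ZMod 2)) *ᵥ p +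
      fun s ↦ ((charActionShift M s : ℤ) : ZMod 2) :=
  rfl

/-- **On the class of an integral vector the permutation is the class of the integral action**:
`γ · v̄ = \overline{(d −c; −b a)v + shift}`. [cite: GrushevskySalvatiManni2004Gradients, p0003 L77–L84 of the held text] -/
theorem symplecticCharPerm_intCast (hM : M ∈ Matrix.symplecticGroup (Fin n) ℤ) (v : Fin n ⊕ Fin n → ℤ) :
    symplecticCharPerm hM (fun s ↦ (v s : ZMod 2)) =
      fun s ↦ (((charActionMatrix M *ᵥ v + charActionShift M) s : ℤ) : ZMod 2) := by
  funext s
  rw [symplecticCharPerm_apply, Pi.add_apply, Pi.add_apply, Int.cast_add]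
  congr 1
  exact (RingHom.map_mulVec (Int.castRingHom (ZMod 2)) (charActionMatrix M) v s).symm

/-- **On the class `(k̄, l̄)` of an integral characteristic the permutation is the class of Lange's
`(k', l')`**: `γ · (k̄; l̄) = (\overline{δk − γl + (γᵗδ)₀}; \overline{αl − βk + (αᵗβ)₀})`.
[cite: GrushevskySalvatiManni2008, Definition 5 (p0004 of the held text)]
[cite: GrushevskySalvatiManni2004Gradients, p0003 L77–L84 of the held text] -/
theorem symplecticCharPerm_sumElim_intCast (hM : M ∈ Matrix.symplecticGroup (Fin n) ℤ)
    (k l : Fin n → ℤ) :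
    symplecticCharPerm hM (Sum.elim (fun i ↦ (k i : ZMod 2)) (fun i ↦ (l i : ZMod 2))) =
      Sum.elim
        (fun i ↦ (((M.toBlocks₂₂ *ᵥ k - M.toBlocks₂₁ *ᵥ l +
          Matrix.diag (M.toBlocks₂₁ * M.toBlocks₂₂ᵀ)) i : ℤ) : ZMod 2))
        (fun i ↦ (((M.toBlocks₁₁ *ᵥ l - M.toBlocks₁₂ *ᵥ k +
          Matrix.diag (M.toBlocks₁₁ * M.toBlocks₁₂ᵀ)) i : ℤ) : ZMod 2)) := by
  have hv : Sum.elim (fun i ↦ (k i : ZMod 2)) (fun i ↦ (l i : ZMod 2)) =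
      fun s ↦ ((Sum.elim k l s : ℤ) : ZMod 2) := by
    funext s
    rcases s with i | i <;> rfl
  rw [hv, symplecticCharPerm_intCast hM, charActionMatrix_mulVec_add_shift]
  funext s
  rcases s with i | i <;> rfl

/-- Every characteristic mod `2` is the class of its `{0,1}`-lift. [folklore] -/
private theorem eq_sumElim_intCast_val₂ (p : Fin n ⊕ Fin n → ZMod 2) :
    p = Sum.elim (fun i ↦ ((((p (Sum.inl i)).val : ℕ) : ℤ) : ZMod 2))
      (fun i ↦ ((((p (Sum.inr i)).val : ℕ) : ℤ) : ZMod 2)) := by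
  funext j
  rcases j with i | i <;> simp

/-- In `ℤ/2`, two elements agree iff they vanish simultaneously. [folklore] -/
private theorem zmod_two_eq_of_iff {x y : ZMod 2} (h : x = 0 ↔ y = 0) : x = y := by
  revert x y
  decide

/-- **"The parity of the characteristics is an invariant"**: `γ · p` is even iff `p` is even
(`Σ ε'ᵢδ'ᵢ = 0 ↔ Σ εᵢδᵢ = 0` in `ℤ/2`). [cite: GrushevskySalvatiManni2004Gradients, p0003 L84–L87 of the held text]
[cite: GrushevskySalvatiManni2008, Definitions 5–6 (p0004 of the held text)] -/
theorem sum_mul_symplecticCharPerm_eq_zero_iff (hM : M ∈ Matrix.symplecticGroup (Fin n) ℤ)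
    (p : Fin n ⊕ Fin n → ZMod 2) :
    ∑ i, symplecticCharPerm hM p (Sum.inl i) * symplecticCharPerm hM p (Sum.inr i) = 0 ↔
      ∑ i, p (Sum.inl i) * p (Sum.inr i) = 0 := by
  set k : Fin n → ℤ := fun i ↦ (((p (Sum.inl i)).val : ℕ) : ℤ) with hk
  set l : Fin n → ℤ := fun i ↦ (((p (Sum.inr i)).val : ℕ) : ℤ) with hl
  have hp : p = Sum.elim (fun i ↦ (k i : ZMod 2)) (fun i ↦ (l i : ZMod 2)) := eq_sumElim_intCast_val₂ p
  rw [hp, symplecticCharPerm_sumElim_intCast hM k l]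
  simp only [Sum.elim_inl, Sum.elim_inr]
  rw [sum_intCast_mul_intCast_eq_zero_iff, sum_intCast_mul_intCast_eq_zero_iff,
    even_dotProduct_symplecticChar_iff hM]

/-- The parity `Σ εᵢδᵢ ∈ ℤ/2` of `γ · p` equals that of `p`.
[cite: GrushevskySalvatiManni2004Gradients, p0003 L84–L87 of the held text] -/
theorem sum_mul_symplecticCharPerm_eq (hM : M ∈ Matrix.symplecticGroup (Fin n) ℤ)
    (p : Fin n ⊕ Fin n → ZMod 2) :
    ∑ i, symplecticCharPerm hM p (Sum.inl i) * symplecticCharPerm hM p (Sum.inr i) =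
      ∑ i, p (Sum.inl i) * p (Sum.inr i) :=
  zmod_two_eq_of_iff (sum_mul_symplecticCharPerm_eq_zero_iff hM p)

/-- **Validation: for `J = (0 −1; 1 0)` the permutation swaps the two halves of the characteristic**,
`J · (ε; δ) = (δ; ε)` (here `(d −c; −b a) = (0 −1; 1 0)`, the shift vanishes, and `−δ = δ` mod `2`).
[cite: GrushevskySalvatiManni2004Gradients, p0003 L77–L84 of the held text]
[cite: Lange2023AbelianVarietiesComplex, §3.3.1 Lemma 3.3.1 (b) (p0170)] -/
theorem symplecticCharPerm_J (p : Fin n ⊕ Fin n → ZMod 2) :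
    symplecticCharPerm (SymplecticGroup.J_mem (Fin n) ℤ) p = fun s ↦ p (Sum.swap s) := by
  have hp := eq_sumElim_intCast_val₂ p
  set k : Fin n → ℤ := fun i ↦ (((p (Sum.inl i)).val : ℕ) : ℤ) with hk
  set l : Fin n → ℤ := fun i ↦ (((p (Sum.inr i)).val : ℕ) : ℤ) with hl
  rw [hp, symplecticCharPerm_sumElim_intCast]
  funext s
  rcases s with i | i
  · simp [Matrix.J, Matrix.neg_mulVec, ZMod.neg_eq_self_mod_two]
  · simp [Matrix.J, Matrix.neg_mulVec, ZMod.neg_eq_self_mod_two]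

end Perm

/-! ### §3 The vanishing theta constants of `M(Z)` are the `γ`-images of those of `Z` -/

section Vanishing

variable {M : Matrix (Fin n ⊕ Fin n) (Fin n ⊕ Fin n) ℤ} {Z : Matrix (Fin n) (Fin n) ℂ}

/-- **`γ · p ∈ vanishingThetaNulls (M(Z)) ↔ p ∈ vanishingThetaNulls Z`** for `M ∈ Sp_{2g}(ℤ)`, `Z ∈ 𝔥_g`:
the permutation preserves parity and `ϑ[γ·p](0, M(Z)) = 0 ↔ ϑ[p](0, Z) = 0` (the transformation formula
at `z = 0`). [cite: GrushevskySalvatiManni2008, Definitions 5–6 (p0004 of the held text)]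
[cite: GrushevskySalvatiManni2004Gradients, p0003 L84–L108 of the held text] -/
theorem symplecticCharPerm_mem_vanishingThetaNulls_iff (hM : M ∈ Matrix.symplecticGroup (Fin n) ℤ)
    (hZ : Z ∈ siegelUpperHalfSpace n) (p : Fin n ⊕ Fin n → ZMod 2) :
    symplecticCharPerm hM p ∈ vanishingThetaNulls (moeb (M.map ((↑) : ℤ → ℂ)) Z) ↔
      p ∈ vanishingThetaNulls Z := by
  set k : Fin n → ℤ := fun i ↦ (((p (Sum.inl i)).val : ℕ) : ℤ) with hk
  set l : Fin n → ℤ := fun i ↦ (((p (Sum.inr i)).val : ℕ) : ℤ) with hl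
  have hp : p = Sum.elim (fun i ↦ (k i : ZMod 2)) (fun i ↦ (l i : ZMod 2)) := eq_sumElim_intCast_val₂ p
  rw [hp, symplecticCharPerm_sumElim_intCast hM k l, sumElim_intCast_mem_vanishingThetaNulls_iff,
    sumElim_intCast_mem_vanishingThetaNulls_iff, even_dotProduct_symplecticChar_iff hM,
    riemannThetaChar_half_zero_moeb_eq_zero_iff hM hZ]

/-- **The set of vanishing even theta constants of `M(Z)` is the image of that of `Z` under the
permutation `γ`.** [cite: GrushevskySalvatiManni2008, Definitions 5–6 (p0004 of the held text)]
[cite: GrushevskySalvatiManni2004Gradients, p0003 L107–L108 of the held text] -/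
theorem image_symplecticCharPerm_vanishingThetaNulls (hM : M ∈ Matrix.symplecticGroup (Fin n) ℤ)
    (hZ : Z ∈ siegelUpperHalfSpace n) :
    symplecticCharPerm hM '' vanishingThetaNulls Z = vanishingThetaNulls (moeb (M.map ((↑) : ℤ → ℂ)) Z) := by
  ext q
  constructor
  · rintro ⟨p, hp, rfl⟩
    exact (symplecticCharPerm_mem_vanishingThetaNulls_iff hM hZ p).2 hp
  · intro hq
    refine ⟨(symplecticCharPerm hM).symm q, ?_, (symplecticCharPerm hM).apply_symm_apply q⟩
    rw [← symplecticCharPerm_mem_vanishingThetaNulls_iff hM hZ, Equiv.apply_symm_apply]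
    exact hq

/-- **The number of vanishing even theta constants is a modular invariant**:
`#vanishingThetaNulls (M(Z)) = #vanishingThetaNulls Z` for `M ∈ Sp_{2g}(ℤ)`, `Z ∈ 𝔥_g` — it is an
invariant of the principally polarised abelian variety, not of the period matrix.
[cite: GrushevskySalvatiManni2004Gradients, p0003 L107–L108 of the held text]
[cite: GrushevskySalvatiManni2008, Definitions 5–6 (p0004 of the held text)]
[cite: vanGeemen1992PicardModular, §3.5–§3.6 (pp. 62–63 of the held text)] -/
theorem natCard_vanishingThetaNulls_moeb_eq (hM : M ∈ Matrix.symplecticGroup (Fin n) ℤ)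
    (hZ : Z ∈ siegelUpperHalfSpace n) :
    Nat.card (vanishingThetaNulls (moeb (M.map ((↑) : ℤ → ℂ)) Z)) = Nat.card (vanishingThetaNulls Z) := by
  refine (Nat.card_congr ((symplecticCharPerm hM).subtypeEquiv fun p ↦ ?_)).symm
  exact (symplecticCharPerm_mem_vanishingThetaNulls_iff hM hZ p).symm

/-- The translations `Z ↦ Z + β` (`β` integral symmetric) do not change the number of vanishing theta
constants (`M = (1 β; 0 1)`). [cite: GrushevskySalvatiManni2008, Definitions 5–6 (p0004 of the held text)]
[cite: Lange2023AbelianVarietiesComplex, §3.3.4 Exercise (7)(c)] -/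
theorem natCard_vanishingThetaNulls_add_intCast_eq {β : Matrix (Fin n) (Fin n) ℤ} (hβ : β.IsSymm)
    (hZ : Z ∈ siegelUpperHalfSpace n) :
    Nat.card (vanishingThetaNulls (Z + β.map ((↑) : ℤ → ℂ))) = Nat.card (vanishingThetaNulls Z) := by
  rw [← moeb_translation β Z]
  exact natCard_vanishingThetaNulls_moeb_eq (fromBlocks_one_symm_mem_symplecticGroup hβ) hZ

end Vanishing

/-! ### §4 On the torus: the number of two-division points on `Θ` is a modular invariant -/

section Torus

variable {M : Matrix (Fin n ⊕ Fin n) (Fin n ⊕ Fin n) ℤ} {Z : Matrix (Fin n) (Fin n) ℂ}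

/-- **`#(X_{M(Z)}[2] ∩ Θ) = #(X_Z[2] ∩ Θ)`** for the principally polarised Siegel tori of `Z ∈ 𝔥_g` and
`M(Z)`, `M ∈ Sp_{2g}(ℤ)` (`g ≥ 1`; any real structures `Φ`, `Φ'`): both counts are
`2^{g−1}(2^g − 1) + #vanishingThetaNulls` (`natCard_twoTorsion_inter_thetaDivisor_eq_add`), and the
number of vanishing even theta constants is a modular invariant.
[cite: GrushevskySalvatiManni2008, Definitions 5–6 (p0004 of the held text)]
[cite: vanGeemen1992PicardModular, §3.5–§3.6 (pp. 62–63 of the held text)] -/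
theorem natCard_twoTorsion_inter_thetaDivisor_moeb_eq (hn : 0 < n)
    (hM : M ∈ Matrix.symplecticGroup (Fin n) ℤ) (hZ : Z ∈ siegelUpperHalfSpace n)
    (hZs : ∀ i j, Z i j = Z j i) (hZpos : (Matrix.of fun i j => (Z i j).im).PosDef)
    (Φ : (Fin n ⊕ Fin n → ℝ) ≃L[ℝ] (Fin n → ℂ))
    (hΦ : ∀ v i, Φ v i = (v (Sum.inl i) : ℂ) + ∑ j, Z i j * (v (Sum.inr j) : ℂ))
    (hMZs : ∀ i j, moeb (M.map ((↑) : ℤ → ℂ)) Z i j = moeb (M.map ((↑) : ℤ → ℂ)) Z j i)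
    (hMZpos : (Matrix.of fun i j => (moeb (M.map ((↑) : ℤ → ℂ)) Z i j).im).PosDef)
    (Φ' : (Fin n ⊕ Fin n → ℝ) ≃L[ℝ] (Fin n → ℂ))
    (hΦ' : ∀ v i, Φ' v i = (v (Sum.inl i) : ℂ) + ∑ j, moeb (M.map ((↑) : ℤ → ℂ)) Z i j * (v (Sum.inr j) : ℂ)) :
    Nat.card {x : (mapMatrixHom Φ' Φ' ((2 : ℤ) • (1 : Matrix (Fin n ⊕ Fin n) (Fin n ⊕ Fin n) ℤ))).ker //
        (x : ComplexTorus Φ') ∈ thetaDivisor (moeb (M.map ((↑) : ℤ → ℂ)) Z) hMZs hMZpos Φ' hΦ'} =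
      Nat.card {x : (mapMatrixHom Φ Φ ((2 : ℤ) • (1 : Matrix (Fin n ⊕ Fin n) (Fin n ⊕ Fin n) ℤ))).ker //
        (x : ComplexTorus Φ) ∈ thetaDivisor Z hZs hZpos Φ hΦ} := by
  rw [natCard_twoTorsion_inter_thetaDivisor_eq_add _ hMZs hMZpos Φ' hΦ' hn,
    natCard_twoTorsion_inter_thetaDivisor_eq_add _ hZs hZpos Φ hΦ hn,
    natCard_vanishingThetaNulls_moeb_eq hM hZ]

end Torus

end ComplexTorus

end Literature.Geometry.Kaehler

end
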